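import Literature.InformationTheory.QuantumCodes.CSSPhenomenologicalThreshold
import Literature.InformationTheory.QuantumCodes.CSSErasureCapacityConverse
import Literature.InformationTheory.QuantumCodes.AbelianTwoBlockNoiseSymmetry
import HarnessLib

/-!
# Phenomenological thresholds are bounded by the erasure thresholds: `P^ph_{p}[D] ≥ ½ P_{2p}[erasure
# uncorrectable]` for EVERY space-time decoder and every number of rounds `T ≥ 1`

Dennis–Kitaev–Landahl–Preskill [DennisEtAl2002] §4–§5: the `T`-round memory experiment with noisy syndrome
measurement (qubit flips at rate `p` in each round, wrong syndrome bits at rate `q`, a perfect closing round,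
space-time decoder `D`; the tree's `CSSPhenom.phenomFailureProb`, §4.2–4.3, §5.2). This file PROVES the genie
(«decoder with side information») comparison that turns every code-capacity CEILING of
`CSSThresholdConverses.lean` / `CSSErasureCapacityConverse.lean` into a phenomenological one: reveal to the decoder
the entire fault history except the qubit faults `e` of one round `t₀`; the space-time syndrome then depends on
`e` only through `H e` (`stSyn_ins`) and the residual is `D'(H e) + e` for an induced code-capacity decoder `D'`
(`corrects_add_ins_iff`), so — averaging over the rest of the history, whose law factorises
(`sum_history_split`, `bernoulliWeight_supp_add_ins`) — the phenomenological failure probability is a MIXTURE of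
code-capacity failure probabilities at flip rate `p`, each `≥ ½ P_{2p}[erasure uncorrectable]` by the erasure
decomposition (`uncorrectableProb_two_mul_le`, Richardson–Urbanke Lemma 4.78):

* `half_uncorrectableProb_le_phenomFailureProb`: `P_{2p}[erasure uncorrectable] ≤ 2 · P^ph_{p,p}[D]` for every
  space-time decoder `D`, every `T ≥ 1` (witnessed by a round `t₀ : Fin T`), `0 ≤ p ≤ 1/2` (isotropic `q = p`, the
  census convention).
* CSS codes with `k ≥ 1`: `1/2 ≤ P^{ph,Z}_p[D_Z] + P^{ph,X}_{p'}[D_X]` for `p + p' = 1/2` and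
  `1/2 ≤ P^{ph,Z}_{1/2}[D_Z]` (`CSSCode.half_le_zPhenom_add_xPhenom`, `CSSCode.half_le_zPhenom_half`); with equal
  sector erasure behaviour `1/4 ≤ P^{ph,Z}_{1/4}[D_Z]` (`CSSCode.quarter_le_zPhenom_quarter_of_symm`); rate form
  `k ≤ n(1 − 2p − 2p' + 2P^{ph,Z}_p + 2P^{ph,X}_{p'})` (`CSSCode.k_le_card_mul_phenom`).
* Families (`k ≥ 1`, rounds `T_i ≥ 1`, ANY space-time decoder families): certified phenomenological threshold lower
  bounds satisfy `a ≤ 1/2`, `a + b ≤ 1/2` (`phenom_thresholds_add_le_half`), `≤ 1/4` for erasure-symmetric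
  families (`phenom_threshold_le_quarter_of_symm`), `a + b ≤ (1 − R)/2` at rate `≥ R`
  (`phenom_thresholds_add_le_half_sub_rate`), and the accuracy-threshold forms.
* Two measurement rates (appended, `uncorrectableProb_le_two_mul_phenomFailureProb_aniso`): the genie bound holds for
  EVERY measurement-error rate `0 ≤ q ≤ 1` (the law of the faults off the revealed round factorises whatever `q` is,
  `indepWeight_supp_add_ins`), so the anisotropic families of the census obey the same ceilings in `p` at every `q`
  (`CSSCode.half_le_zPhenom_half_aniso`, `CSSCode.quarter_le_zPhenom_quarter_aniso_of_symm`,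
  `phenom_aniso_rate_le_quarter_of_symm`).
* Abelian two-block codes (all generalized-bicycle / bivariate-bicycle codes; appended): their sectors have equal
  erasure behaviour (`AbelianTwoBlock.xUncorrectableProb_eq`), so every space-time decoder of either sector fails
  with probability `≥ 1/4` at `p = q = 1/4` (`AbelianTwoBlock.quarter_le_zPhenom_quarter`, `…_x…`,
  `BB.Code.quarter_le_zPhenom_quarter`) and every family has phenomenological threshold `≤ 1/4` per sector
  (`AbelianTwoBlock.phenom_threshold_le_quarter`, `…x_…`).

## References

* [DennisEtAl2002] J. Math. Phys. 43 (2002) 4452, §4.2–4.3 (error history, q and p), §5.2–5.3 (Prob_fail, p = q),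
  §4.6 (p_c).
* [RichardsonUrbanke2008] Modern Coding Theory, Lemma 4.78 (Erasure Decomposition Lemma).
* [StaceBarrettDoherty2009] PRL 102 (2009) 200501, p. 2 (no-cloning bound on the loss threshold).
* [BennettDivincenzoSmolin1997] PRL 78 (1997) 3217, p. 3218 (Q = 1 − 2ε).

## Mathlib / tree search

Tree: `CSSPhenom.phenomFailureProb`, `stSyn`, `stMatrix`, `proj`, `proj_apply`, `projLinear`, `stTrivial`,
`ToricCode.phenomenologicalWeight_self`, `card_historyLoc` (CSSPhenomenologicalThreshold); `supp`, `vecOf`,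
`supp_vecOf`, `vecOf_supp` (IrreducibleClusters); `bernoulliWeight`, `sum_bernoulliWeight`;
`uncorrectableProb_two_mul_le`, `CSSCode.one_le_uncorrectableProb_add`, `CSSCode.uncorrectableProb_one`,
`not_belowThreshold_of_le` (CSSThresholdConverses); `CSSCode.k_le_card_mul_erasure` (CSSErasureCapacityConverse).
Mathlib: `Finset.sum_nbij'`, `Finset.sum_product'`, `Fintype.sum_sum_type`, `Fintype.sum_prod_type`.
-/

namespace Literature.InformationTheory.QuantumCodes

open Finset Matrix Filter Topology

namespace CSSPhenom

variable {ι V : Type*} [Fintype ι] [DecidableEq ι] [Fintype V] [DecidableEq V] {T : ℕ}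

/-! ### Inserting one round of qubit faults into a history -/

omit [Fintype ι] [DecidableEq ι] [Fintype V] [DecidableEq V] in
/-- The projection of the history consisting of the qubit faults `e` in round `t₀` alone is `e`.
[cite: DennisEtAl2002, §6.1 (the projected chain Π)] -/
theorem proj_ins (t₀ : Fin T) (e : V → ZMod 2) :
    proj (Sum.elim (fun vt : V × Fin T => if vt.2 = t₀ then e vt.1 else 0) (fun _ : ι × Fin T => 0) :
      History ι V T) = e := by
  funext v
  rw [proj_apply]
  simp

omit [Fintype ι] [DecidableEq ι] [Fintype V] [DecidableEq V] in
/-- `Π` is additive. [cite: DennisEtAl2002, §6.1 (Π)] -/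
theorem proj_add (E E' : History ι V T) : proj (E + E') = proj E + proj E' :=
  (projLinear ι V T).map_add E E'

omit [DecidableEq V] in
/-- **The record sees one round's qubit faults only through their syndrome**: the space-time boundary of the
round-`t₀` qubit faults `e` is `H e` placed on the space-time checks of slice `t₀`.
[cite: DennisEtAl2002, §4.3 (∂E: the syndrome of the slice)] -/
theorem stSyn_ins (H : Matrix ι V (ZMod 2)) (t₀ : Fin T) (e : V → ZMod 2) :
    stSyn H T (Sum.elim (fun vt : V × Fin T => if vt.2 = t₀ then e vt.1 else 0) (fun _ : ι × Fin T => 0)) =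
      fun x => if x.2 = t₀.castSucc then (H *ᵥ e) x.1 else 0 := by
  funext x
  simp only [stSyn, Matrix.mulVec, dotProduct, stMatrix, Matrix.of_apply, Fintype.sum_sum_type, Sum.elim_inl,
    Sum.elim_inr, mul_zero, Finset.sum_const_zero, add_zero]
  rw [Fintype.sum_prod_type]
  have hv : ∀ v : V, ∑ t : Fin T, (if x.2 = t.castSucc then H x.1 v else 0) * (if t = t₀ then e v else 0) =
      if x.2 = t₀.castSucc then H x.1 v * e v else 0 := by
    intro v
    rw [Finset.sum_eq_single t₀]
    · simp only [if_true]
      split_ifs <;> simp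
    · intro t _ ht
      simp [ht]
    · intro h
      exact absurd (mem_univ _) h
  simp only [hv]
  split_ifs with hx
  · rfl
  · simp

/-- **Splitting a history** into the round-`t₀` qubit faults and the rest: every sum over histories is the
iterated sum over histories with no round-`t₀` qubit fault and over the round-`t₀` qubit faults.
[cite: DennisEtAl2002, §4.2 (the error history as independent slices)] -/
theorem sum_history_split (t₀ : Fin T) (f : History ι V T → ℝ) :
    ∑ E : History ι V T, f E =
      ∑ E' ∈ univ.filter (fun E' : History ι V T => ∀ v, E' (Sum.inl (v, t₀)) = 0),
        ∑ e : V → ZMod 2,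
          f (E' + Sum.elim (fun vt : V × Fin T => if vt.2 = t₀ then e vt.1 else 0) (fun _ : ι × Fin T => 0)) := by
  rw [← Finset.sum_product']
  symm
  refine Finset.sum_nbij'
    (fun x : History ι V T × (V → ZMod 2) =>
      x.1 + Sum.elim (fun vt : V × Fin T => if vt.2 = t₀ then x.2 vt.1 else 0) (fun _ : ι × Fin T => 0))
    (fun E : History ι V T =>
      ((Sum.elim (fun vt : V × Fin T => if vt.2 = t₀ then 0 else E (Sum.inl vt)) (fun ct : ι × Fin T => E (Sum.inr ct))
        : History ι V T), fun v => E (Sum.inl (v, t₀))))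
    (fun _ _ => mem_univ _) ?_ ?_ ?_ (fun _ _ => rfl)
  · intro E _
    simp only [Finset.mem_product, Finset.mem_filter, Finset.mem_univ, true_and, and_true]
    intro v
    simp
  · rintro ⟨E', e⟩ hx
    simp only [Finset.mem_product, Finset.mem_filter, Finset.mem_univ, true_and, and_true] at hx
    refine Prod.ext ?_ ?_
    · funext ℓ
      rcases ℓ with ⟨v, t⟩ | ⟨c, t⟩
      · by_cases ht : t = t₀
        · subst ht
          simp [hx v]
        · simp [ht]
      · simp
    · funext v
      simp [hx v]
  · intro E _
    funext ℓ
    rcases ℓ with ⟨v, t⟩ | ⟨c, t⟩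
    · by_cases ht : t = t₀
      · subst ht
        simp
      · simp [ht]
    · simp

/-- The support of a split history: the faults off round `t₀`'s qubits and (a copy of) the support of `e`, so
`|supp(E' + e)| = |supp E'| + |supp e|`. [cite: DennisEtAl2002, §4.2 (marked links of distinct slices)] -/
theorem card_supp_add_ins (t₀ : Fin T) {E' : History ι V T} (hE' : ∀ v, E' (Sum.inl (v, t₀)) = 0)
    (e : V → ZMod 2) :
    (supp (E' + Sum.elim (fun vt : V × Fin T => if vt.2 = t₀ then e vt.1 else 0) (fun _ : ι × Fin T => 0))).card =
      (supp E').card + (supp e).card := by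
  have hdisj : Disjoint (supp E') ((supp e).map ⟨fun v => (Sum.inl (v, t₀) : HistoryLoc V ι T),
      fun v w h => by simpa using h⟩) := by
    rw [Finset.disjoint_left]
    intro ℓ hℓ hℓ'
    rw [Finset.mem_map] at hℓ'
    obtain ⟨v, _, rfl⟩ := hℓ'
    simp [supp, hE' v] at hℓ
  have hunion : supp (E' + Sum.elim (fun vt : V × Fin T => if vt.2 = t₀ then e vt.1 else 0)
      (fun _ : ι × Fin T => 0)) =
      supp E' ∪ (supp e).map ⟨fun v => (Sum.inl (v, t₀) : HistoryLoc V ι T), fun v w h => by simpa using h⟩ := by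
    ext ℓ
    simp only [supp, mem_filter, mem_univ, true_and, Pi.add_apply, mem_union, Finset.mem_map,
      Function.Embedding.coeFn_mk]
    rcases ℓ with ⟨v, t⟩ | ⟨c, t⟩
    · by_cases ht : t = t₀
      · subst ht
        simp [hE' v]
      · have ht' : t₀ ≠ t := fun h => ht h.symm
        simp [ht, ht']
    · simp
  rw [hunion, Finset.card_union_of_disjoint hdisj, Finset.card_map]

omit [Fintype ι] [DecidableEq ι] [Fintype V] [DecidableEq V] in
/-- A history with no round-`t₀` qubit fault has at most `N − n` faults (`N` space-time locations, `n` qubits).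
[cite: DennisEtAl2002, §4.2 (T time slices)] -/
theorem card_supp_le_of_vanish [Fintype ι] [Fintype V] (t₀ : Fin T) {E' : History ι V T}
    (hE' : ∀ v, E' (Sum.inl (v, t₀)) = 0) :
    (supp E').card ≤ Fintype.card (HistoryLoc V ι T) - Fintype.card V := by
  classical
  have hsub : supp E' ⊆ univ \ (univ : Finset V).map ⟨fun v => (Sum.inl (v, t₀) : HistoryLoc V ι T),
      fun v w h => by simpa using h⟩ := by
    intro ℓ hℓ
    rw [Finset.mem_sdiff]
    refine ⟨mem_univ _, fun h => ?_⟩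
    rw [Finset.mem_map] at h
    obtain ⟨v, _, rfl⟩ := h
    simp [supp, hE' v] at hℓ
  have h := Finset.card_le_card hsub
  rw [Finset.card_sdiff_of_subset (Finset.subset_univ _), Finset.card_map, Finset.card_univ, Finset.card_univ] at h
  exact h

/-- **Factorisation of the isotropic law** across the split: `prob(E' + e) = prob'(E') · p^{|e|}(1-p)^{n-|e|}`
with `prob'(E') = p^{|E'|}(1-p)^{N-n-|E'|}` the law of the faults off round `t₀`'s qubits.
[cite: DennisEtAl2002, §4.4 eq. (prob_E) (independent links)] -/
theorem bernoulliWeight_supp_add_ins (t₀ : Fin T) {E' : History ι V T} (hE' : ∀ v, E' (Sum.inl (v, t₀)) = 0)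
    (e : V → ZMod 2) (p : ℝ) :
    bernoulliWeight p (supp (E' + Sum.elim (fun vt : V × Fin T => if vt.2 = t₀ then e vt.1 else 0)
        (fun _ : ι × Fin T => 0))) =
      p ^ (supp E').card * (1 - p) ^ (Fintype.card (HistoryLoc V ι T) - Fintype.card V - (supp E').card) *
        bernoulliWeight p (supp e) := by
  rw [bernoulliWeight, bernoulliWeight, card_supp_add_ins t₀ hE' e]
  have h1 := card_supp_le_of_vanish t₀ hE'
  have h2 : (supp e).card ≤ Fintype.card V := Finset.card_le_univ _
  have h3 : Fintype.card V ≤ Fintype.card (HistoryLoc V ι T) :=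
    Fintype.card_le_of_injective (fun v => (Sum.inl (v, t₀) : HistoryLoc V ι T)) fun v w h => by
      simpa using h
  have hexp : Fintype.card (HistoryLoc V ι T) - ((supp E').card + (supp e).card) =
      (Fintype.card (HistoryLoc V ι T) - Fintype.card V - (supp E').card) + (Fintype.card V - (supp e).card) := by
    omega
  rw [hexp, pow_add, pow_add]
  ring

omit [DecidableEq V] in
/-- **The induced code-capacity decoder.** With the rest `E'` of the history revealed, the space-time decoder `D`
succeeds on `E' + e` iff the code-capacity decoder `s ↦ Π(D(∂E' + s@t₀)) + Π(E')` corrects `e` from its syndrome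
`H e`. [cite: DennisEtAl2002, §4.3 (success iff E + E' is homologically trivial) with §6.1 (Π)] -/
theorem corrects_add_ins_iff (H : Matrix ι V (ZMod 2)) (SX : Set (V → ZMod 2)) (D : STDecoder ι V T)
    (t₀ : Fin T) (E' : History ι V T) (e : V → ZMod 2) :
    D.Corrects (stSyn H T) (stTrivial SX T)
        (E' + Sum.elim (fun vt : V × Fin T => if vt.2 = t₀ then e vt.1 else 0) (fun _ : ι × Fin T => 0)) ↔
      Decoder.Corrects
        (fun s : ι → ZMod 2 => proj (D (stSyn H T E' + fun x => if x.2 = t₀.castSucc then s x.1 else 0)) + proj E')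
        (fun e => H *ᵥ e) SX e := by
  classical
  have hsyn : stSyn H T (E' + Sum.elim (fun vt : V × Fin T => if vt.2 = t₀ then e vt.1 else 0)
      (fun _ : ι × Fin T => 0)) =
      stSyn H T E' + fun x => if x.2 = t₀.castSucc then (H *ᵥ e) x.1 else 0 := by
    rw [← stSyn_ins H t₀ e]
    simp only [stSyn, Matrix.mulVec_add]
  simp only [Decoder.Corrects, stTrivial, Set.mem_setOf_eq, hsyn, proj_add, proj_ins, add_assoc]

omit [Fintype ι] [DecidableEq ι] in
/-- The independent flip law summed over error VECTORS (through their supports) is a probability distribution.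
[cite: DennisEtAl2002, §4.4 eq. (prob_E)] -/
theorem sum_bernoulliWeight_supp {X : Type*} [Fintype X] [DecidableEq X] (p : ℝ) :
    ∑ x : X → ZMod 2, bernoulliWeight p (supp x) = 1 := by
  rw [← sum_bernoulliWeight (V := X) p]
  exact Finset.sum_nbij' supp vecOf (fun _ _ => mem_univ _) (fun _ _ => mem_univ _) (fun x _ => vecOf_supp x)
    (fun S _ => supp_vecOf S) (fun _ _ => rfl)

/-! ### The genie bound -/

/-- **PHENOMENOLOGICAL ≥ ½ · ERASURE.** For every check matrix `H`, trivial set `SX` (a subspace), every number of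
rounds `T ≥ 1` (a round `t₀ : Fin T`), EVERY space-time decoder `D` and `0 ≤ p ≤ 1/2`:
`P_{2p}[erasure uncorrectable] ≤ 2 · P^ph_{p,p}[D fails]` — the phenomenological failure probability is a mixture,
over the rest of the history, of code-capacity failure probabilities of induced decoders at flip rate `p`, each
`≥ ½ P_{2p}[erasure uncorrectable]`. [cite: DennisEtAl2002, §5.2 (Prob_fail); RichardsonUrbanke2008, Lemma 4.78 (Erasure Decomposition Lemma)] -/
theorem uncorrectableProb_le_two_mul_phenomFailureProb (H : Matrix ι V (ZMod 2))
    (SX : Submodule (ZMod 2) (V → ZMod 2)) (D : STDecoder ι V T) (t₀ : Fin T) {p : ℝ} (hp0 : 0 ≤ p)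
    (hp : p ≤ 1 / 2) :
    ErasureDecoder.uncorrectableProb {x | H *ᵥ x = 0} (SX : Set (V → ZMod 2)) (2 * p) ≤
      2 * phenomFailureProb H T (SX : Set (V → ZMod 2)) D p p := by
  classical
  -- the weight of the faults off round `t₀`'s qubits
  have hw0 : ∀ E' : History ι V T, 0 ≤ p ^ (supp E').card *
      (1 - p) ^ (Fintype.card (HistoryLoc V ι T) - Fintype.card V - (supp E').card) :=
    fun E' => mul_nonneg (pow_nonneg hp0 _) (pow_nonneg (by linarith) _)
  -- Step 1: the failure probability as a mixture of code-capacity failure probabilities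
  have hph : phenomFailureProb H T (SX : Set (V → ZMod 2)) D p p =
      ∑ E' ∈ univ.filter (fun E' : History ι V T => ∀ v, E' (Sum.inl (v, t₀)) = 0),
        p ^ (supp E').card * (1 - p) ^ (Fintype.card (HistoryLoc V ι T) - Fintype.card V - (supp E').card) *
          ∑ e ∈ univ.filter (fun e : V → ZMod 2 => ¬ Decoder.Corrects
              (fun s : ι → ZMod 2 =>
                proj (D (stSyn H T E' + fun x => if x.2 = t₀.castSucc then s x.1 else 0)) + proj E')
              (fun e => H *ᵥ e) (SX : Set (V → ZMod 2)) e),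
            bernoulliWeight p (supp e) := by
    unfold phenomFailureProb
    rw [Finset.sum_congr rfl fun E _ => ToricCode.phenomenologicalWeight_self T p (supp E), Finset.sum_filter,
      sum_history_split t₀]
    refine Finset.sum_congr rfl fun E' hE' => ?_
    rw [Finset.mem_filter] at hE'
    rw [Finset.sum_filter, Finset.mul_sum]
    refine Finset.sum_congr rfl fun e _ => ?_
    rw [corrects_add_ins_iff H (SX : Set (V → ZMod 2)) D t₀ E' e, bernoulliWeight_supp_add_ins t₀ hE'.2 e p]
    split_ifs <;> simp
  -- Step 2: the mixture weights sum to one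
  have hmass : ∑ E' ∈ univ.filter (fun E' : History ι V T => ∀ v, E' (Sum.inl (v, t₀)) = 0),
      p ^ (supp E').card * (1 - p) ^ (Fintype.card (HistoryLoc V ι T) - Fintype.card V - (supp E').card) = 1 := by
    have h := sum_bernoulliWeight_supp (X := HistoryLoc V ι T) p
    rw [sum_history_split t₀] at h
    refine Eq.trans ?_ h
    refine Finset.sum_congr rfl fun E' hE' => ?_
    rw [Finset.mem_filter] at hE'
    rw [Finset.sum_congr rfl fun e _ => bernoulliWeight_supp_add_ins t₀ hE'.2 e p, ← Finset.mul_sum,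
      sum_bernoulliWeight_supp, mul_one]
  -- Step 3: each induced code-capacity decoder obeys the erasure decomposition bound
  rw [hph, Finset.mul_sum]
  calc ErasureDecoder.uncorrectableProb {x | H *ᵥ x = 0} (SX : Set (V → ZMod 2)) (2 * p)
      = ∑ E' ∈ univ.filter (fun E' : History ι V T => ∀ v, E' (Sum.inl (v, t₀)) = 0),
          p ^ (supp E').card * (1 - p) ^ (Fintype.card (HistoryLoc V ι T) - Fintype.card V - (supp E').card) *
            ErasureDecoder.uncorrectableProb {x | H *ᵥ x = 0} (SX : Set (V → ZMod 2)) (2 * p) := by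
        rw [← Finset.sum_mul, hmass, one_mul]
    _ ≤ _ := by
        refine Finset.sum_le_sum fun E' _ => ?_
        have h := uncorrectableProb_two_mul_le H SX
          (fun s : ι → ZMod 2 =>
            proj (D (stSyn H T E' + fun x => if x.2 = t₀.castSucc then s x.1 else 0)) + proj E') hp0 hp
        have h' := mul_le_mul_of_nonneg_left h (hw0 E')
        linarith

end CSSPhenom

/-! ### CSS codes: the two sectors' phenomenological failure probabilities -/

section CSS

open CSSPhenom

variable {RX RZ V : Type*} [Fintype V] [DecidableEq V] [Fintype RX] [DecidableEq RX] [Fintype RZ] [DecidableEq RZ]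
  {T : ℕ}

omit [DecidableEq RZ] in
/-- **Complementary rates defeat every pair of space-time decoders.** For a CSS code with `k ≥ 1`, rounds `T ≥ 1`,
ANY space-time decoders `D_Z` (phase flips, noisy `X`-syndrome) and `D_X` (bit flips, noisy `Z`-syndrome) with any
numbers of rounds, and `p + p' = 1/2`, `p, p' ≥ 0`: `1/2 ≤ P^{ph,Z}_p[D_Z] + P^{ph,X}_{p'}[D_X]`.
[cite: DennisEtAl2002, §5.2–5.3 (Prob_fail, p = q); StaceBarrettDoherty2009, p. 2 (no-cloning bound)] -/
theorem CSSCode.half_le_zPhenom_add_xPhenom {T' : ℕ} [DecidableEq RZ] (C : CSSCode RX RZ V) (hk : 0 < C.k)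
    (DZ : STDecoder RX V T) (DX : STDecoder RZ V T') (t₀ : Fin T) (t₀' : Fin T') {p p' : ℝ} (hp0 : 0 ≤ p)
    (hp'0 : 0 ≤ p') (hsum : p + p' = 1 / 2) :
    1 / 2 ≤ phenomFailureProb C.HX T (C.rowSpZ : Set (V → ZMod 2)) DZ p p +
      phenomFailureProb C.HZ T' (C.rowSpX : Set (V → ZMod 2)) DX p' p' := by
  have hZ := uncorrectableProb_le_two_mul_phenomFailureProb C.HX C.rowSpZ DZ t₀ hp0 (by linarith)
  have hX := uncorrectableProb_le_two_mul_phenomFailureProb C.HZ C.rowSpX DX t₀' hp'0 (by linarith)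
  have h1 := C.one_le_uncorrectableProb_add hk (y := 2 * p) (by linarith) (by linarith)
  rw [show 1 - 2 * p = 2 * p' by linarith] at h1
  linarith

omit [Fintype RZ] [DecidableEq RZ] in
/-- **At flip rate `1/2` every space-time decoder fails with probability `≥ 1/2`** (`k ≥ 1`, `T ≥ 1`).
[cite: DennisEtAl2002, §5.2–5.3; RichardsonUrbanke2008, Lemma 4.78] -/
theorem CSSCode.half_le_zPhenom_half [Fintype RZ] (C : CSSCode RX RZ V) (hk : 0 < C.k) (DZ : STDecoder RX V T)
    (t₀ : Fin T) :
    1 / 2 ≤ phenomFailureProb C.HX T (C.rowSpZ : Set (V → ZMod 2)) DZ (1 / 2) (1 / 2) := by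
  have hZ := uncorrectableProb_le_two_mul_phenomFailureProb C.HX C.rowSpZ DZ t₀ (p := 1 / 2) (by norm_num) le_rfl
  rw [show (2 : ℝ) * (1 / 2) = 1 by norm_num, C.uncorrectableProb_one hk] at hZ
  linarith

omit [DecidableEq RZ] in
/-- **Erasure-symmetric codes** (the two sectors have the same erasure-uncorrectability probabilities, e.g. toric,
planar, abelian two-block codes): every space-time decoder of either sector fails with probability `≥ 1/4` at flip
rate `1/4` (`k ≥ 1`, `T ≥ 1`). [cite: DennisEtAl2002, §5.2–5.3; StaceBarrettDoherty2009, p. 2] -/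
theorem CSSCode.quarter_le_zPhenom_quarter_of_symm (C : CSSCode RX RZ V) (hk : 0 < C.k)
    (hsymm : ∀ y, ErasureDecoder.uncorrectableProb {x | C.HZ *ᵥ x = 0} (C.rowSpX : Set (V → ZMod 2)) y =
      ErasureDecoder.uncorrectableProb {x | C.HX *ᵥ x = 0} (C.rowSpZ : Set (V → ZMod 2)) y)
    (DZ : STDecoder RX V T) (t₀ : Fin T) :
    1 / 4 ≤ phenomFailureProb C.HX T (C.rowSpZ : Set (V → ZMod 2)) DZ (1 / 4) (1 / 4) := by
  have hZ := uncorrectableProb_le_two_mul_phenomFailureProb C.HX C.rowSpZ DZ t₀ (p := 1 / 4) (by norm_num)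
    (by norm_num)
  have h1 := C.one_le_uncorrectableProb_add hk (y := 1 / 2) (by norm_num) (by norm_num)
  rw [show (1 : ℝ) - 1 / 2 = 1 / 2 by norm_num, hsymm] at h1
  rw [show (2 : ℝ) * (1 / 4) = 1 / 2 by norm_num] at hZ
  linarith

omit [DecidableEq RZ] in
/-- **Rate form**: `k ≤ n · (1 − 2p − 2p' + 2 P^{ph,Z}_p[D_Z] + 2 P^{ph,X}_{p'}[D_X])` for every CSS code, all
space-time decoders, `T, T' ≥ 1`, `p, p' ≥ 0`, `p + p' ≤ 1/2`.
[cite: BennettDivincenzoSmolin1997, p. 3218 (Q ≤ 1 − 2ε); DennisEtAl2002, §5.2] -/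
theorem CSSCode.k_le_card_mul_phenom {T' : ℕ} [DecidableEq RZ] (C : CSSCode RX RZ V) (DZ : STDecoder RX V T)
    (DX : STDecoder RZ V T') (t₀ : Fin T) (t₀' : Fin T') {p p' : ℝ} (hp : 0 ≤ p) (hp' : 0 ≤ p')
    (hpp : p + p' ≤ 1 / 2) :
    (C.k : ℝ) ≤ Fintype.card V * (1 - 2 * p - 2 * p' +
      2 * phenomFailureProb C.HX T (C.rowSpZ : Set (V → ZMod 2)) DZ p p +
      2 * phenomFailureProb C.HZ T' (C.rowSpX : Set (V → ZMod 2)) DX p' p') := by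
  have h := C.k_le_card_mul_erasure (a := 2 * p) (b := 2 * p') (by linarith) (by linarith) (by linarith)
  have hZ := uncorrectableProb_le_two_mul_phenomFailureProb C.HX C.rowSpZ DZ t₀ hp (by linarith)
  have hX := uncorrectableProb_le_two_mul_phenomFailureProb C.HZ C.rowSpX DX t₀' hp' (by linarith)
  have hn : (0 : ℝ) ≤ Fintype.card V := Nat.cast_nonneg _
  nlinarith [mul_le_mul_of_nonneg_left hZ hn, mul_le_mul_of_nonneg_left hX hn]

end CSS

/-! ### Families: phenomenological threshold ceilings -/

section Thresholds

open CSSPhenom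

/-- A rate strictly inside two overlapping constraints. [folklore] -/
private theorem exists_rate_between'' {a b c : ℝ} (hc : 0 ≤ c) (ha : 0 < a) (hb : 0 < b) (h : c < a + b) :
    ∃ y : ℝ, 0 ≤ y ∧ y ≤ c ∧ y < a ∧ c - y < b := by
  refine ⟨min c (max 0 ((c - b + a) / 2)), le_min hc (le_max_left _ _), min_le_left _ _, ?_, ?_⟩
  · exact lt_of_le_of_lt (min_le_right _ _) (max_lt ha (by linarith))
  · have : c - b < min c (max 0 ((c - b + a) / 2)) :=
      lt_min (by linarith) (lt_of_lt_of_le (by linarith) (le_max_right _ _))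
    linarith

variable {RX RZ Q : ℕ → Type*} [∀ i, Fintype (Q i)] [∀ i, DecidableEq (Q i)] [∀ i, Fintype (RX i)]
  [∀ i, DecidableEq (RX i)] [∀ i, Fintype (RZ i)] [∀ i, DecidableEq (RZ i)]

omit [∀ i, DecidableEq (RZ i)] in
/-- **Phenomenological threshold `≤ 1/2` for every space-time decoder family** (non-vacuity of the scale; `k ≥ 1`,
rounds `T_i ≥ 1`). [cite: DennisEtAl2002, §4.6 (p_c) and §5.3 (p = q)] -/
theorem phenom_threshold_le_half (C : ∀ i, CSSCode (RX i) (RZ i) (Q i)) (hk : ∀ i, 0 < (C i).k)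
    (T : ℕ → ℕ) (hT : ∀ i, 0 < T i) (DZ : ∀ i, STDecoder (RX i) (Q i) (T i)) {a : ℝ}
    (ha : IsThresholdLowerBound
      (fun i p => phenomFailureProb (C i).HX (T i) ((C i).rowSpZ : Set (Q i → ZMod 2)) (DZ i) p p) a) :
    a ≤ 1 / 2 := by
  by_contra h
  push Not at h
  refine not_belowThreshold_of_le (c := 1 / 2) (by norm_num) (fun i => ?_) (ha (1 / 2) (by norm_num) h)
  exact (C i).half_le_zPhenom_half (hk i) (DZ i) ⟨0, hT i⟩

/-- **THE PHENOMENOLOGICAL CONVERSE.** For a family of CSS codes with `k ≥ 1`, rounds `T_i, T'_i ≥ 1` and ANY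
space-time decoder families: certified phenomenological threshold lower bounds `a` (`Z`-sector) and `b` (`X`-sector)
satisfy `a + b ≤ 1/2`. [cite: DennisEtAl2002, §4.6 and §5.3; StaceBarrettDoherty2009, p. 2 (no-cloning bound); RichardsonUrbanke2008, Lemma 4.78] -/
theorem phenom_thresholds_add_le_half (C : ∀ i, CSSCode (RX i) (RZ i) (Q i)) (hk : ∀ i, 0 < (C i).k)
    (T T' : ℕ → ℕ) (hT : ∀ i, 0 < T i) (hT' : ∀ i, 0 < T' i) (DZ : ∀ i, STDecoder (RX i) (Q i) (T i))
    (DX : ∀ i, STDecoder (RZ i) (Q i) (T' i)) {a b : ℝ}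
    (ha : IsThresholdLowerBound
      (fun i p => phenomFailureProb (C i).HX (T i) ((C i).rowSpZ : Set (Q i → ZMod 2)) (DZ i) p p) a)
    (hb : IsThresholdLowerBound
      (fun i p => phenomFailureProb (C i).HZ (T' i) ((C i).rowSpX : Set (Q i → ZMod 2)) (DX i) p p) b) :
    a + b ≤ 1 / 2 := by
  by_contra h
  push Not at h
  have ha1 := phenom_threshold_le_half C hk T hT DZ ha
  have hb1 : b ≤ 1 / 2 := phenom_threshold_le_half (fun i => (C i).swap)
    (fun i => by rw [CSSCode.k_swap]; exact hk i) T' hT' DX hb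
  rcases le_or_gt a 0 with ha0 | ha0
  · linarith
  rcases le_or_gt b 0 with hb0 | hb0
  · linarith
  obtain ⟨p, hp0, hp1, hpa, hpb⟩ := exists_rate_between'' (c := 1 / 2) (by norm_num) ha0 hb0 h
  have hZ := ha p hp0 hpa
  have hX := hb (1 / 2 - p) (by linarith) hpb
  have hsum : Tendsto (fun i =>
      phenomFailureProb (C i).HX (T i) ((C i).rowSpZ : Set (Q i → ZMod 2)) (DZ i) p p +
        phenomFailureProb (C i).HZ (T' i) ((C i).rowSpX : Set (Q i → ZMod 2)) (DX i) (1 / 2 - p) (1 / 2 - p))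
      atTop (𝓝 0) := by
    simpa using hZ.add hX
  exact not_belowThreshold_of_le
    (P := fun i _ => phenomFailureProb (C i).HX (T i) ((C i).rowSpZ : Set (Q i → ZMod 2)) (DZ i) p p +
        phenomFailureProb (C i).HZ (T' i) ((C i).rowSpX : Set (Q i → ZMod 2)) (DX i) (1 / 2 - p) (1 / 2 - p))
    (p := p) (by norm_num : (0 : ℝ) < 1 / 2)
    (fun i => (C i).half_le_zPhenom_add_xPhenom (hk i) (DZ i) (DX i) ⟨0, hT i⟩ ⟨0, hT' i⟩ hp0 (by linarith)
      (by linarith)) hsum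

/-- **Accuracy-threshold form**: `p_c^{ph,Z} + p_c^{ph,X} ≤ 1/2` for ANY space-time decoder families.
[cite: DennisEtAl2002, §4.6 (p_c) and §5.3 (p = q)] -/
theorem phenom_accuracyThresholds_add_le_half (C : ∀ i, CSSCode (RX i) (RZ i) (Q i)) (hk : ∀ i, 0 < (C i).k)
    (T T' : ℕ → ℕ) (hT : ∀ i, 0 < T i) (hT' : ∀ i, 0 < T' i) (DZ : ∀ i, STDecoder (RX i) (Q i) (T i))
    (DX : ∀ i, STDecoder (RZ i) (Q i) (T' i)) :
    accuracyThreshold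
        (fun i p => phenomFailureProb (C i).HX (T i) ((C i).rowSpZ : Set (Q i → ZMod 2)) (DZ i) p p) +
      accuracyThreshold
        (fun i p => phenomFailureProb (C i).HZ (T' i) ((C i).rowSpX : Set (Q i → ZMod 2)) (DX i) p p) ≤ 1 / 2 :=
  phenom_thresholds_add_le_half C hk T T' hT hT' DZ DX (isThresholdLowerBound_accuracyThreshold _)
    (isThresholdLowerBound_accuracyThreshold _)

omit [∀ i, DecidableEq (RZ i)] in
/-- **Erasure-symmetric families: phenomenological threshold `≤ 1/4` for EVERY space-time decoder family** and
every schedule of rounds `T_i ≥ 1` (toric, planar, abelian two-block families).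
[cite: DennisEtAl2002, §4.6 and §5.3; StaceBarrettDoherty2009, p. 2] -/
theorem phenom_threshold_le_quarter_of_symm (C : ∀ i, CSSCode (RX i) (RZ i) (Q i)) (hk : ∀ i, 0 < (C i).k)
    (hsymm : ∀ i y, ErasureDecoder.uncorrectableProb {x : Q i → ZMod 2 | (C i).HZ *ᵥ x = 0}
        ((C i).rowSpX : Set (Q i → ZMod 2)) y =
      ErasureDecoder.uncorrectableProb {x : Q i → ZMod 2 | (C i).HX *ᵥ x = 0}
        ((C i).rowSpZ : Set (Q i → ZMod 2)) y)
    (T : ℕ → ℕ) (hT : ∀ i, 0 < T i) (DZ : ∀ i, STDecoder (RX i) (Q i) (T i)) {a : ℝ}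
    (ha : IsThresholdLowerBound
      (fun i p => phenomFailureProb (C i).HX (T i) ((C i).rowSpZ : Set (Q i → ZMod 2)) (DZ i) p p) a) :
    a ≤ 1 / 4 := by
  by_contra h
  push Not at h
  refine not_belowThreshold_of_le (c := 1 / 4) (by norm_num) (fun i => ?_) (ha (1 / 4) (by norm_num) h)
  exact (C i).quarter_le_zPhenom_quarter_of_symm (hk i) (hsymm i) (DZ i) ⟨0, hT i⟩

omit [∀ i, DecidableEq (RZ i)] in
/-- Accuracy-threshold form for erasure-symmetric families: `p_c^{ph} ≤ 1/4`, every space-time decoder family.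
[cite: DennisEtAl2002, §4.6 and §5.3] -/
theorem phenom_accuracyThreshold_le_quarter_of_symm (C : ∀ i, CSSCode (RX i) (RZ i) (Q i))
    (hk : ∀ i, 0 < (C i).k)
    (hsymm : ∀ i y, ErasureDecoder.uncorrectableProb {x : Q i → ZMod 2 | (C i).HZ *ᵥ x = 0}
        ((C i).rowSpX : Set (Q i → ZMod 2)) y =
      ErasureDecoder.uncorrectableProb {x : Q i → ZMod 2 | (C i).HX *ᵥ x = 0}
        ((C i).rowSpZ : Set (Q i → ZMod 2)) y)
    (T : ℕ → ℕ) (hT : ∀ i, 0 < T i) (DZ : ∀ i, STDecoder (RX i) (Q i) (T i)) :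
    accuracyThreshold
        (fun i p => phenomFailureProb (C i).HX (T i) ((C i).rowSpZ : Set (Q i → ZMod 2)) (DZ i) p p) ≤ 1 / 4 :=
  phenom_threshold_le_quarter_of_symm C hk hsymm T hT DZ (isThresholdLowerBound_accuracyThreshold _)

/-- **Two below-threshold phenomenological rates cost `2p + 2p'` of rate** (`k ≥ 1`, rate `≥ R`, rounds `≥ 1`,
any space-time decoders, `p + p' ≤ 1/2`). [cite: BennettDivincenzoSmolin1997, p. 3218 (Q ≤ 1 − 2ε); DennisEtAl2002, §5.3] -/
theorem phenom_rates_add_le_half_sub_rate (C : ∀ i, CSSCode (RX i) (RZ i) (Q i)) (hk : ∀ i, 0 < (C i).k)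
    {R : ℝ} (hR : ∀ i, R * Fintype.card (Q i) ≤ (C i).k) (T T' : ℕ → ℕ) (hT : ∀ i, 0 < T i)
    (hT' : ∀ i, 0 < T' i) (DZ : ∀ i, STDecoder (RX i) (Q i) (T i)) (DX : ∀ i, STDecoder (RZ i) (Q i) (T' i))
    {p p' : ℝ} (hp : 0 ≤ p) (hp' : 0 ≤ p') (hpp : p + p' ≤ 1 / 2)
    (hZ : BelowThreshold
      (fun i p => phenomFailureProb (C i).HX (T i) ((C i).rowSpZ : Set (Q i → ZMod 2)) (DZ i) p p) p)
    (hX : BelowThreshold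
      (fun i p => phenomFailureProb (C i).HZ (T' i) ((C i).rowSpX : Set (Q i → ZMod 2)) (DX i) p p) p') :
    p + p' ≤ (1 - R) / 2 := by
  have hbound : ∀ i, R ≤ 1 - 2 * p - 2 * p' +
      (2 * phenomFailureProb (C i).HX (T i) ((C i).rowSpZ : Set (Q i → ZMod 2)) (DZ i) p p +
        2 * phenomFailureProb (C i).HZ (T' i) ((C i).rowSpX : Set (Q i → ZMod 2)) (DX i) p' p') := by
    intro i
    have hn : (0 : ℝ) < Fintype.card (Q i) := by
      exact_mod_cast lt_of_lt_of_le (hk i) (C i).k_le_card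
    have h := (hR i).trans ((C i).k_le_card_mul_phenom (DZ i) (DX i) ⟨0, hT i⟩ ⟨0, hT' i⟩ hp hp' hpp)
    rw [mul_comm] at h
    have h' := le_of_mul_le_mul_left h hn
    linarith
  have hlim : Tendsto (fun i => 1 - 2 * p - 2 * p' +
      (2 * phenomFailureProb (C i).HX (T i) ((C i).rowSpZ : Set (Q i → ZMod 2)) (DZ i) p p +
        2 * phenomFailureProb (C i).HZ (T' i) ((C i).rowSpX : Set (Q i → ZMod 2)) (DX i) p' p'))
      atTop (𝓝 (1 - 2 * p - 2 * p' + (2 * 0 + 2 * 0))) :=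
    tendsto_const_nhds.add ((hZ.const_mul 2).add (hX.const_mul 2))
  have := le_of_tendsto_of_tendsto' tendsto_const_nhds hlim hbound
  linarith

omit [∀ i, DecidableEq (Q i)] [∀ i, DecidableEq (RX i)] [∀ i, Fintype (RZ i)] [∀ i, DecidableEq (RZ i)] in
/-- A family with `k ≥ 1` and `R n ≤ k` has `R ≤ 1`. [cite: BravyiEtAl2024, §4, proof of Lemma 1 (k = n − rk H^X − rk H^Z)] -/
private theorem rate_le_one' (C : ∀ i, CSSCode (RX i) (RZ i) (Q i)) (hk : ∀ i, 0 < (C i).k) {R : ℝ}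
    (hR : ∀ i, R * Fintype.card (Q i) ≤ (C i).k) : R ≤ 1 := by
  have hn : (0 : ℝ) < Fintype.card (Q 0) := by
    exact_mod_cast lt_of_lt_of_le (hk 0) (C 0).k_le_card
  have h1 : ((C 0).k : ℝ) ≤ Fintype.card (Q 0) := by exact_mod_cast (C 0).k_le_card
  have h2 : R * Fintype.card (Q 0) ≤ 1 * Fintype.card (Q 0) := by linarith [hR 0]
  exact le_of_mul_le_mul_right h2 hn

omit [∀ i, DecidableEq (RZ i)] in
/-- **One sector alone, any space-time decoder family**: a below-threshold phenomenological rate `0 ≤ p ≤ 1/2`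
forces `p ≤ (1 − R)/2` (`k ≥ 1`, rate `≥ R`, rounds `≥ 1`; take the other sector's erasure rate `0`).
[cite: BennettDivincenzoSmolin1997, p. 3218 (Q ≤ 1 − 2ε); DennisEtAl2002, §5.3] -/
theorem phenom_rate_le_half_sub_rate (C : ∀ i, CSSCode (RX i) (RZ i) (Q i)) (hk : ∀ i, 0 < (C i).k)
    {R : ℝ} (hR : ∀ i, R * Fintype.card (Q i) ≤ (C i).k) (T : ℕ → ℕ) (hT : ∀ i, 0 < T i)
    (DZ : ∀ i, STDecoder (RX i) (Q i) (T i)) {p : ℝ} (hp : 0 ≤ p) (hp1 : p ≤ 1 / 2)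
    (hZ : BelowThreshold
      (fun i p => phenomFailureProb (C i).HX (T i) ((C i).rowSpZ : Set (Q i → ZMod 2)) (DZ i) p p) p) :
    p ≤ (1 - R) / 2 := by
  have hbound : ∀ i, R ≤ 1 - 2 * p +
      2 * phenomFailureProb (C i).HX (T i) ((C i).rowSpZ : Set (Q i → ZMod 2)) (DZ i) p p := by
    intro i
    have hn : (0 : ℝ) < Fintype.card (Q i) := by
      exact_mod_cast lt_of_lt_of_le (hk i) (C i).k_le_card
    have h1 := (C i).k_le_card_mul_erasure (a := 2 * p) (b := 0) (by linarith) le_rfl (by linarith)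
    rw [uncorrectableProb_zero] at h1
    have h2 := uncorrectableProb_le_two_mul_phenomFailureProb (C i).HX (C i).rowSpZ (DZ i) ⟨0, hT i⟩ hp hp1
    have h3 : ((C i).k : ℝ) ≤ Fintype.card (Q i) * (1 - 2 * p +
        2 * phenomFailureProb (C i).HX (T i) ((C i).rowSpZ : Set (Q i → ZMod 2)) (DZ i) p p) := by
      nlinarith [mul_le_mul_of_nonneg_left h2 hn.le]
    have h := (hR i).trans h3
    rw [mul_comm] at h
    have h' := le_of_mul_le_mul_left h hn
    linarith
  have hlim : Tendsto (fun i => 1 - 2 * p +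
      2 * phenomFailureProb (C i).HX (T i) ((C i).rowSpZ : Set (Q i → ZMod 2)) (DZ i) p p)
      atTop (𝓝 (1 - 2 * p + 2 * 0)) :=
    tendsto_const_nhds.add (hZ.const_mul 2)
  have := le_of_tendsto_of_tendsto' tendsto_const_nhds hlim hbound
  linarith

omit [∀ i, DecidableEq (RX i)] in
/-- The `X`-sector alone (the `X ↔ Z` exchange of `phenom_rate_le_half_sub_rate`).
[cite: BennettDivincenzoSmolin1997, p. 3218 (Q ≤ 1 − 2ε); DennisEtAl2002, §5.3] -/
theorem x_phenom_rate_le_half_sub_rate (C : ∀ i, CSSCode (RX i) (RZ i) (Q i)) (hk : ∀ i, 0 < (C i).k)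
    {R : ℝ} (hR : ∀ i, R * Fintype.card (Q i) ≤ (C i).k) (T' : ℕ → ℕ) (hT' : ∀ i, 0 < T' i)
    (DX : ∀ i, STDecoder (RZ i) (Q i) (T' i)) {p' : ℝ} (hp' : 0 ≤ p') (hp1 : p' ≤ 1 / 2)
    (hX : BelowThreshold
      (fun i p => phenomFailureProb (C i).HZ (T' i) ((C i).rowSpX : Set (Q i → ZMod 2)) (DX i) p p) p') :
    p' ≤ (1 - R) / 2 :=
  phenom_rate_le_half_sub_rate (fun i => (C i).swap) (fun i => by rw [CSSCode.k_swap]; exact hk i)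
    (fun i => by rw [CSSCode.k_swap]; exact hR i) T' hT' DX hp' hp1 hX

/-- **THE RATE–PHENOMENOLOGICAL-THRESHOLD TRADEOFF**: for a family of CSS codes with `k ≥ 1`, rate `≥ R`, rounds
`T_i, T'_i ≥ 1` and ANY space-time decoder families, certified phenomenological threshold lower bounds `a`
(`Z`-sector) and `b` (`X`-sector) satisfy `a + b ≤ (1 − R)/2`.
[cite: BennettDivincenzoSmolin1997, p. 3218 (Q ≤ 1 − 2ε); DennisEtAl2002, §4.6 and §5.3] -/
theorem phenom_thresholds_add_le_half_sub_rate (C : ∀ i, CSSCode (RX i) (RZ i) (Q i)) (hk : ∀ i, 0 < (C i).k)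
    {R : ℝ} (hR : ∀ i, R * Fintype.card (Q i) ≤ (C i).k) (T T' : ℕ → ℕ) (hT : ∀ i, 0 < T i)
    (hT' : ∀ i, 0 < T' i) (DZ : ∀ i, STDecoder (RX i) (Q i) (T i)) (DX : ∀ i, STDecoder (RZ i) (Q i) (T' i))
    {a b : ℝ}
    (ha : IsThresholdLowerBound
      (fun i p => phenomFailureProb (C i).HX (T i) ((C i).rowSpZ : Set (Q i → ZMod 2)) (DZ i) p p) a)
    (hb : IsThresholdLowerBound
      (fun i p => phenomFailureProb (C i).HZ (T' i) ((C i).rowSpX : Set (Q i → ZMod 2)) (DX i) p p) b) :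
    a + b ≤ (1 - R) / 2 := by
  by_contra h
  push Not at h
  have hab1 : a + b ≤ 1 / 2 := phenom_thresholds_add_le_half C hk T T' hT hT' DZ DX ha hb
  have hR1 : R ≤ 1 := rate_le_one' C hk hR
  set c := ((1 - R) / 2 + (a + b)) / 2 with hc
  have hc0 : 0 ≤ c := by rw [hc]; linarith
  have hRc : (1 - R) / 2 < c := by rw [hc]; linarith
  have hcab : c < a + b := by rw [hc]; linarith
  have hc1 : c ≤ 1 / 2 := by linarith
  rcases le_or_gt a 0 with ha0 | ha0
  · have h2 := x_phenom_rate_le_half_sub_rate C hk hR T' hT' DX hc0 hc1 (hb c hc0 (by linarith))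
    linarith
  rcases le_or_gt b 0 with hb0 | hb0
  · have h2 := phenom_rate_le_half_sub_rate C hk hR T hT DZ hc0 hc1 (ha c hc0 (by linarith))
    linarith
  obtain ⟨y, hy0, hyc, hya, hyb⟩ := exists_rate_between'' hc0 ha0 hb0 hcab
  have h2 := phenom_rates_add_le_half_sub_rate C hk hR T T' hT hT' DZ DX hy0 (by linarith : (0 : ℝ) ≤ c - y)
    (by linarith) (ha y hy0 hya) (hb (c - y) (by linarith) hyb)
  linarith

/-- **Accuracy-threshold form**: `p_c^{ph,Z} + p_c^{ph,X} ≤ (1 − R)/2`, any space-time decoder families.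
[cite: BennettDivincenzoSmolin1997, p. 3218 (Q ≤ 1 − 2ε); DennisEtAl2002, §4.6 (p_c)] -/
theorem phenom_accuracyThresholds_add_le_half_sub_rate (C : ∀ i, CSSCode (RX i) (RZ i) (Q i))
    (hk : ∀ i, 0 < (C i).k) {R : ℝ} (hR : ∀ i, R * Fintype.card (Q i) ≤ (C i).k) (T T' : ℕ → ℕ)
    (hT : ∀ i, 0 < T i) (hT' : ∀ i, 0 < T' i) (DZ : ∀ i, STDecoder (RX i) (Q i) (T i))
    (DX : ∀ i, STDecoder (RZ i) (Q i) (T' i)) :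
    accuracyThreshold
        (fun i p => phenomFailureProb (C i).HX (T i) ((C i).rowSpZ : Set (Q i → ZMod 2)) (DZ i) p p) +
      accuracyThreshold
        (fun i p => phenomFailureProb (C i).HZ (T' i) ((C i).rowSpX : Set (Q i → ZMod 2)) (DX i) p p)
      ≤ (1 - R) / 2 :=
  phenom_thresholds_add_le_half_sub_rate C hk hR T T' hT hT' DZ DX (isThresholdLowerBound_accuracyThreshold _)
    (isThresholdLowerBound_accuracyThreshold _)

end Thresholds

/-! ### Abelian two-block codes: every space-time decoder of either sector fails w.p. `≥ 1/4` at `p = q = 1/4` -/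

namespace AbelianTwoBlock

open CSSPhenom

section OneCode

variable {G : Type*} [Fintype G] [AddCommGroup G] [DecidableEq G] {T : ℕ}

/-- **Abelian two-block codes, phenomenological noise `p = q = 1/4`, `Z`-sector**: for `k ≥ 1`, every
space-time decoder and every number of rounds `T ≥ 1`, the failure probability is `≥ 1/4` (equal sector erasure
behaviour, `xUncorrectableProb_eq`). [cite: DennisEtAl2002, §5.2–5.3; BravyiEtAl2024, §4 Lemma 1] -/
theorem quarter_le_zPhenom_quarter (a b : G → ZMod 2) (hk : 0 < (css a b).k) (D : STDecoder G (G ⊕ G) T)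
    (t₀ : Fin T) :
    1 / 4 ≤ phenomFailureProb (css a b).HX T ((css a b).rowSpZ : Set (G ⊕ G → ZMod 2)) D (1 / 4) (1 / 4) :=
  (css a b).quarter_le_zPhenom_quarter_of_symm hk (fun y => xUncorrectableProb_eq a b y) D t₀

/-- **`X`-sector**: every space-time decoder of the `Z`-syndrome record fails with probability `≥ 1/4` at
`p = q = 1/4` (`k ≥ 1`, `T ≥ 1`). [cite: DennisEtAl2002, §5.2–5.3; BravyiEtAl2024, §4 Lemma 1] -/
theorem quarter_le_xPhenom_quarter (a b : G → ZMod 2) (hk : 0 < (css a b).k) (D : STDecoder G (G ⊕ G) T)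
    (t₀ : Fin T) :
    1 / 4 ≤ phenomFailureProb (css a b).HZ T ((css a b).rowSpX : Set (G ⊕ G → ZMod 2)) D (1 / 4) (1 / 4) :=
  (css a b).swap.quarter_le_zPhenom_quarter_of_symm (by rw [CSSCode.k_swap]; exact hk)
    (fun y => (xUncorrectableProb_eq a b y).symm) D t₀

end OneCode

section Family

variable {G : ℕ → Type*} [∀ i, Fintype (G i)] [∀ i, AddCommGroup (G i)] [∀ i, DecidableEq (G i)]

/-- **Every family of abelian two-block codes with `k ≥ 1` has phenomenological threshold `≤ 1/4`, `Z`-sector,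
for EVERY space-time decoder family and every schedule of rounds `T_i ≥ 1`.**
[cite: DennisEtAl2002, §4.6 and §5.3; BravyiEtAl2024, §4 Lemma 1] -/
theorem phenom_threshold_le_quarter (a b : ∀ i, G i → ZMod 2) (hk : ∀ i, 0 < (css (a i) (b i)).k) (T : ℕ → ℕ)
    (hT : ∀ i, 0 < T i) (D : ∀ i, STDecoder (G i) (G i ⊕ G i) (T i)) {t : ℝ}
    (ht : IsThresholdLowerBound (fun i p => phenomFailureProb (css (a i) (b i)).HX (T i)
      ((css (a i) (b i)).rowSpZ : Set (G i ⊕ G i → ZMod 2)) (D i) p p) t) :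
    t ≤ 1 / 4 :=
  phenom_threshold_le_quarter_of_symm (fun i => css (a i) (b i)) hk (fun i y => xUncorrectableProb_eq (a i) (b i) y)
    T hT D ht

/-- **Phenomenological threshold `≤ 1/4`, `X`-sector**, every space-time decoder family.
[cite: DennisEtAl2002, §4.6 and §5.3; BravyiEtAl2024, §4 Lemma 1] -/
theorem x_phenom_threshold_le_quarter (a b : ∀ i, G i → ZMod 2) (hk : ∀ i, 0 < (css (a i) (b i)).k) (T : ℕ → ℕ)
    (hT : ∀ i, 0 < T i) (D : ∀ i, STDecoder (G i) (G i ⊕ G i) (T i)) {t : ℝ}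
    (ht : IsThresholdLowerBound (fun i p => phenomFailureProb (css (a i) (b i)).HZ (T i)
      ((css (a i) (b i)).rowSpX : Set (G i ⊕ G i → ZMod 2)) (D i) p p) t) :
    t ≤ 1 / 4 :=
  phenom_threshold_le_quarter_of_symm (fun i => (css (a i) (b i)).swap)
    (fun i => by rw [CSSCode.k_swap]; exact hk i) (fun i y => (xUncorrectableProb_eq (a i) (b i) y).symm) T hT D ht

/-- Accuracy-threshold form: `p_c^{ph,Z} ≤ 1/4` for every family of abelian two-block codes with `k ≥ 1`, every
space-time decoder family. [cite: DennisEtAl2002, §4.6 and §5.3] -/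
theorem phenom_accuracyThreshold_le_quarter (a b : ∀ i, G i → ZMod 2) (hk : ∀ i, 0 < (css (a i) (b i)).k)
    (T : ℕ → ℕ) (hT : ∀ i, 0 < T i) (D : ∀ i, STDecoder (G i) (G i ⊕ G i) (T i)) :
    accuracyThreshold (fun i p => phenomFailureProb (css (a i) (b i)).HX (T i)
      ((css (a i) (b i)).rowSpZ : Set (G i ⊕ G i → ZMod 2)) (D i) p p) ≤ 1 / 4 :=
  phenom_threshold_le_quarter a b hk T hT D (isThresholdLowerBound_accuracyThreshold _)

end Family

end AbelianTwoBlock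

namespace BB.Code

open CSSPhenom

variable {ℓ m : ℕ} [NeZero ℓ] [NeZero m] {T : ℕ}

/-- **Bivariate-bicycle codes, `p = q = 1/4`**: for `k ≥ 1`, every space-time decoder (`Z`-sector) and every
`T ≥ 1`, the failure probability is `≥ 1/4`. [cite: DennisEtAl2002, §5.2–5.3; BravyiEtAl2024, §4 Lemma 1] -/
theorem quarter_le_zPhenom_quarter (C : BB.Code ℓ m) (hk : 0 < C.css.k)
    (D : STDecoder (Mono ℓ m) (Mono ℓ m ⊕ Mono ℓ m) T) (t₀ : Fin T) :
    1 / 4 ≤ phenomFailureProb C.css.HX T (C.css.rowSpZ : Set (Mono ℓ m ⊕ Mono ℓ m → ZMod 2)) D (1 / 4) (1 / 4) :=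
  C.css.quarter_le_zPhenom_quarter_of_symm hk (fun y => C.xUncorrectableProb_eq y) D t₀

/-- `X`-sector of a bivariate-bicycle code: every space-time decoder fails with probability `≥ 1/4` at
`p = q = 1/4`. [cite: DennisEtAl2002, §5.2–5.3; BravyiEtAl2024, §4 Lemma 1] -/
theorem quarter_le_xPhenom_quarter (C : BB.Code ℓ m) (hk : 0 < C.css.k)
    (D : STDecoder (Mono ℓ m) (Mono ℓ m ⊕ Mono ℓ m) T) (t₀ : Fin T) :
    1 / 4 ≤ phenomFailureProb C.css.HZ T (C.css.rowSpX : Set (Mono ℓ m ⊕ Mono ℓ m → ZMod 2)) D (1 / 4) (1 / 4) :=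
  C.css.swap.quarter_le_zPhenom_quarter_of_symm (by rw [CSSCode.k_swap]; exact hk)
    (fun y => (C.xUncorrectableProb_eq y).symm) D t₀

end BB.Code

/-! ### Two measurement rates: the genie bound for every `q` -/

namespace CSSPhenom

variable {ι V : Type*} [Fintype ι] [DecidableEq ι] [Fintype V] [DecidableEq V] {T : ℕ}

/-- The support of a split history as a disjoint union: the faults off round `t₀`'s qubits and the copy of `supp e`.
[cite: DennisEtAl2002, §4.2 (marked links of distinct slices)] -/
theorem supp_add_ins_eq (t₀ : Fin T) {E' : History ι V T} (hE' : ∀ v, E' (Sum.inl (v, t₀)) = 0)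
    (e : V → ZMod 2) :
    supp (E' + Sum.elim (fun vt : V × Fin T => if vt.2 = t₀ then e vt.1 else 0) (fun _ : ι × Fin T => 0)) =
      supp E' ∪ (supp e).map ⟨fun v => (Sum.inl (v, t₀) : HistoryLoc V ι T), fun v w h => by simpa using h⟩ := by
  ext ℓ
  simp only [supp, mem_filter, mem_univ, true_and, Pi.add_apply, mem_union, Finset.mem_map,
    Function.Embedding.coeFn_mk]
  rcases ℓ with ⟨v, t⟩ | ⟨c, t⟩
  · by_cases ht : t = t₀
    · subst ht
      simp [hE' v]
    · have ht' : t₀ ≠ t := fun h => ht h.symm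
      simp [ht, ht']
  · simp

/-- **Factorisation of the two-rate law** across the split: for the phenomenological rates (`p` on qubit faults, `q`
on measurement faults), `prob(E' + e) = prob'(E') · p^{|e|}(1−p)^{n−|e|}`, where `prob'(E')` is the weight of the
faults off round `t₀`'s qubits. [cite: DennisEtAl2002, §4.2 and §4.4 (independent links, rates p and q)] -/
theorem indepWeight_supp_add_ins (t₀ : Fin T) {E' : History ι V T} (hE' : ∀ v, E' (Sum.inl (v, t₀)) = 0)
    (e : V → ZMod 2) (p q : ℝ) :
    indepWeight (phenomRate p q) (supp (E' + Sum.elim (fun vt : V × Fin T => if vt.2 = t₀ then e vt.1 else 0)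
        (fun _ : ι × Fin T => 0))) =
      ((∏ i ∈ supp E', phenomRate (Q := V) (C := ι) (T := T) p q i) *
          ∏ i ∈ (univ \ (univ : Finset V).map ⟨fun v => (Sum.inl (v, t₀) : HistoryLoc V ι T),
              fun v w h => by simpa using h⟩) \ supp E', (1 - phenomRate (Q := V) (C := ι) (T := T) p q i)) *
        bernoulliWeight p (supp e) := by
  classical
  set emb : V ↪ HistoryLoc V ι T := ⟨fun v => (Sum.inl (v, t₀) : HistoryLoc V ι T), fun v w h => by simpa using h⟩
    with hemb
  have hsupp := supp_add_ins_eq t₀ hE' e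
  rw [← hemb] at hsupp
  -- disjointness of the two parts of the support
  have hdisj : Disjoint (supp E') ((supp e).map emb) := by
    rw [Finset.disjoint_left]
    intro ℓ hℓ hℓ'
    rw [Finset.mem_map] at hℓ'
    obtain ⟨v, _, rfl⟩ := hℓ'
    simp [supp, hemb, hE' v] at hℓ
  -- the complement splits along `A = emb '' univ`
  have hcompl : univ \ (supp E' ∪ (supp e).map emb) =
      ((univ \ (univ : Finset V).map emb) \ supp E') ∪ ((univ : Finset V).map emb \ (supp e).map emb) := by
    ext ℓ
    simp only [Finset.mem_sdiff, Finset.mem_univ, true_and, Finset.mem_union, Finset.mem_map, hemb,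
      Function.Embedding.coeFn_mk, supp, mem_filter]
    rcases ℓ with ⟨v, t⟩ | ⟨c, t⟩
    · by_cases ht : t = t₀
      · subst ht
        simp [hE' v]
      · have ht' : t₀ ≠ t := fun h => ht h.symm
        simp [ht']
    · simp
  have hdisj2 : Disjoint ((univ \ (univ : Finset V).map emb) \ supp E')
      ((univ : Finset V).map emb \ (supp e).map emb) := by
    rw [Finset.disjoint_left]
    intro ℓ h1 h2
    rw [Finset.mem_sdiff, Finset.mem_sdiff] at h1
    rw [Finset.mem_sdiff] at h2
    exact h1.1.2 h2.1
  -- the two `A`-parts are powers of `p` and `1 - p`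
  have hprodA : ∏ i ∈ (supp e).map emb, phenomRate (Q := V) (C := ι) (T := T) p q i = p ^ (supp e).card := by
    rw [Finset.prod_map]
    simp [hemb, phenomRate]
  have hprodA' : ∏ i ∈ (univ : Finset V).map emb \ (supp e).map emb,
      (1 - phenomRate (Q := V) (C := ι) (T := T) p q i) = (1 - p) ^ (Fintype.card V - (supp e).card) := by
    have hconst : ∀ i ∈ (univ : Finset V).map emb \ (supp e).map emb,
        (1 - phenomRate (Q := V) (C := ι) (T := T) p q i) = 1 - p := by
      intro i hi
      rw [Finset.mem_sdiff, Finset.mem_map] at hi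
      obtain ⟨v, _, rfl⟩ := hi.1
      simp [hemb, phenomRate]
    rw [Finset.prod_congr rfl hconst, Finset.prod_const,
      Finset.card_sdiff_of_subset (Finset.map_subset_map.2 (Finset.subset_univ _)), Finset.card_map,
      Finset.card_map, Finset.card_univ]
  unfold indepWeight
  rw [hsupp, Finset.prod_union hdisj, hcompl, Finset.prod_union hdisj2, hprodA, hprodA', bernoulliWeight]
  ring

/-- The two-rate law summed over error VECTORS is a probability distribution.
[cite: DennisEtAl2002, §4.4 eq. (prob_E)] -/
theorem sum_indepWeight_supp {X : Type*} [Fintype X] [DecidableEq X] (r : X → ℝ) :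
    ∑ x : X → ZMod 2, indepWeight r (supp x) = 1 := by
  rw [← sum_indepWeight r]
  exact Finset.sum_nbij' supp vecOf (fun _ _ => mem_univ _) (fun _ _ => mem_univ _) (fun x _ => vecOf_supp x)
    (fun S _ => supp_vecOf S) (fun _ _ => rfl)

/-- **PHENOMENOLOGICAL ≥ ½ · ERASURE for EVERY measurement-error rate `q`.** For every check matrix `H`, trivial
subspace `SX`, rounds `T ≥ 1` (`t₀ : Fin T`), EVERY space-time decoder `D`, qubit-fault rate `0 ≤ p ≤ 1/2` and
measurement-fault rate `0 ≤ q ≤ 1`: `P_{2p}[erasure uncorrectable] ≤ 2 · P^ph_{p,q}[D fails]` (the record — however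
reliable — sees one round's qubit faults only through their syndrome). [cite: DennisEtAl2002, §4.2 (rates p and q) and §5.2 (Prob_fail); RichardsonUrbanke2008, Lemma 4.78 (Erasure Decomposition Lemma)] -/
theorem uncorrectableProb_le_two_mul_phenomFailureProb_aniso (H : Matrix ι V (ZMod 2))
    (SX : Submodule (ZMod 2) (V → ZMod 2)) (D : STDecoder ι V T) (t₀ : Fin T) {p q : ℝ} (hp0 : 0 ≤ p)
    (hp : p ≤ 1 / 2) (hq0 : 0 ≤ q) (hq1 : q ≤ 1) :
    ErasureDecoder.uncorrectableProb {x | H *ᵥ x = 0} (SX : Set (V → ZMod 2)) (2 * p) ≤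
      2 * phenomFailureProb H T (SX : Set (V → ZMod 2)) D p q := by
  classical
  have hr0 : ∀ i : HistoryLoc V ι T, 0 ≤ phenomRate (Q := V) (C := ι) (T := T) p q i := by
    rintro (_ | _) <;> simp [phenomRate, hp0, hq0]
  have hr1 : ∀ i : HistoryLoc V ι T, phenomRate (Q := V) (C := ι) (T := T) p q i ≤ 1 := by
    rintro (_ | _)
    · simp [phenomRate]; linarith
    · simp [phenomRate, hq1]
  -- the weight of the faults off round `t₀`'s qubits and its non-negativity
  have hw0 : ∀ E' : History ι V T, 0 ≤ (∏ i ∈ supp E', phenomRate (Q := V) (C := ι) (T := T) p q i) *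
      ∏ i ∈ (univ \ (univ : Finset V).map ⟨fun v => (Sum.inl (v, t₀) : HistoryLoc V ι T),
          fun v w h => by simpa using h⟩) \ supp E', (1 - phenomRate (Q := V) (C := ι) (T := T) p q i) :=
    fun E' => mul_nonneg (Finset.prod_nonneg fun i _ => hr0 i)
      (Finset.prod_nonneg fun i _ => sub_nonneg.2 (hr1 i))
  -- Step 1: the failure probability as a mixture of code-capacity failure probabilities
  have hph : phenomFailureProb H T (SX : Set (V → ZMod 2)) D p q =
      ∑ E' ∈ univ.filter (fun E' : History ι V T => ∀ v, E' (Sum.inl (v, t₀)) = 0),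
        ((∏ i ∈ supp E', phenomRate (Q := V) (C := ι) (T := T) p q i) *
          ∏ i ∈ (univ \ (univ : Finset V).map ⟨fun v => (Sum.inl (v, t₀) : HistoryLoc V ι T),
              fun v w h => by simpa using h⟩) \ supp E', (1 - phenomRate (Q := V) (C := ι) (T := T) p q i)) *
          ∑ e ∈ univ.filter (fun e : V → ZMod 2 => ¬ Decoder.Corrects
              (fun s : ι → ZMod 2 =>
                proj (D (stSyn H T E' + fun x => if x.2 = t₀.castSucc then s x.1 else 0)) + proj E')
              (fun e => H *ᵥ e) (SX : Set (V → ZMod 2)) e),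
            bernoulliWeight p (supp e) := by
    unfold phenomFailureProb phenomenologicalWeight
    rw [Finset.sum_filter, sum_history_split t₀]
    refine Finset.sum_congr rfl fun E' hE' => ?_
    rw [Finset.mem_filter] at hE'
    rw [Finset.sum_filter, Finset.mul_sum]
    refine Finset.sum_congr rfl fun e _ => ?_
    rw [corrects_add_ins_iff H (SX : Set (V → ZMod 2)) D t₀ E' e, indepWeight_supp_add_ins t₀ hE'.2 e p q]
    split_ifs <;> simp
  -- Step 2: the mixture weights sum to one
  have hmass : ∑ E' ∈ univ.filter (fun E' : History ι V T => ∀ v, E' (Sum.inl (v, t₀)) = 0),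
      (∏ i ∈ supp E', phenomRate (Q := V) (C := ι) (T := T) p q i) *
        ∏ i ∈ (univ \ (univ : Finset V).map ⟨fun v => (Sum.inl (v, t₀) : HistoryLoc V ι T),
            fun v w h => by simpa using h⟩) \ supp E', (1 - phenomRate (Q := V) (C := ι) (T := T) p q i) = 1 := by
    have h := sum_indepWeight_supp (X := HistoryLoc V ι T) (phenomRate (Q := V) (C := ι) (T := T) p q)
    rw [sum_history_split t₀] at h
    refine Eq.trans ?_ h
    refine Finset.sum_congr rfl fun E' hE' => ?_
    rw [Finset.mem_filter] at hE'
    rw [Finset.sum_congr rfl fun e _ => indepWeight_supp_add_ins t₀ hE'.2 e p q, ← Finset.mul_sum,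
      sum_bernoulliWeight_supp, mul_one]
  -- Step 3: erasure decomposition for each induced decoder
  rw [hph, Finset.mul_sum]
  calc ErasureDecoder.uncorrectableProb {x | H *ᵥ x = 0} (SX : Set (V → ZMod 2)) (2 * p)
      = ∑ E' ∈ univ.filter (fun E' : History ι V T => ∀ v, E' (Sum.inl (v, t₀)) = 0),
          ((∏ i ∈ supp E', phenomRate (Q := V) (C := ι) (T := T) p q i) *
            ∏ i ∈ (univ \ (univ : Finset V).map ⟨fun v => (Sum.inl (v, t₀) : HistoryLoc V ι T),
                fun v w h => by simpa using h⟩) \ supp E', (1 - phenomRate (Q := V) (C := ι) (T := T) p q i)) *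
            ErasureDecoder.uncorrectableProb {x | H *ᵥ x = 0} (SX : Set (V → ZMod 2)) (2 * p) := by
        rw [← Finset.sum_mul, hmass, one_mul]
    _ ≤ _ := by
        refine Finset.sum_le_sum fun E' _ => ?_
        have h := uncorrectableProb_two_mul_le H SX
          (fun s : ι → ZMod 2 =>
            proj (D (stSyn H T E' + fun x => if x.2 = t₀.castSucc then s x.1 else 0)) + proj E') hp0 hp
        have h' := mul_le_mul_of_nonneg_left h (hw0 E')
        linarith

end CSSPhenom

section CSSAniso

open CSSPhenom

variable {RX RZ V : Type*} [Fintype V] [DecidableEq V] [Fintype RX] [DecidableEq RX] [Fintype RZ] {T : ℕ}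

/-- **At qubit-fault rate `1/2` every space-time decoder fails with probability `≥ 1/2`, whatever the measurement
rate `0 ≤ q ≤ 1`** (`k ≥ 1`, `T ≥ 1`). [cite: DennisEtAl2002, §4.2 and §5.2; RichardsonUrbanke2008, Lemma 4.78] -/
theorem CSSCode.half_le_zPhenom_half_aniso (C : CSSCode RX RZ V) (hk : 0 < C.k) (DZ : STDecoder RX V T)
    (t₀ : Fin T) {q : ℝ} (hq0 : 0 ≤ q) (hq1 : q ≤ 1) :
    1 / 2 ≤ phenomFailureProb C.HX T (C.rowSpZ : Set (V → ZMod 2)) DZ (1 / 2) q := by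
  have hZ := uncorrectableProb_le_two_mul_phenomFailureProb_aniso C.HX C.rowSpZ DZ t₀ (p := 1 / 2)
    (by norm_num) le_rfl hq0 hq1
  rw [show (2 : ℝ) * (1 / 2) = 1 by norm_num, C.uncorrectableProb_one hk] at hZ
  linarith

/-- **Erasure-symmetric codes, any measurement rate**: every space-time decoder fails with probability `≥ 1/4` at
qubit-fault rate `1/4`, for every `0 ≤ q ≤ 1` (`k ≥ 1`, `T ≥ 1`). [cite: DennisEtAl2002, §4.2 and §5.2; StaceBarrettDoherty2009, p. 2] -/
theorem CSSCode.quarter_le_zPhenom_quarter_aniso_of_symm (C : CSSCode RX RZ V) (hk : 0 < C.k)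
    (hsymm : ∀ y, ErasureDecoder.uncorrectableProb {x | C.HZ *ᵥ x = 0} (C.rowSpX : Set (V → ZMod 2)) y =
      ErasureDecoder.uncorrectableProb {x | C.HX *ᵥ x = 0} (C.rowSpZ : Set (V → ZMod 2)) y)
    (DZ : STDecoder RX V T) (t₀ : Fin T) {q : ℝ} (hq0 : 0 ≤ q) (hq1 : q ≤ 1) :
    1 / 4 ≤ phenomFailureProb C.HX T (C.rowSpZ : Set (V → ZMod 2)) DZ (1 / 4) q := by
  have hZ := uncorrectableProb_le_two_mul_phenomFailureProb_aniso C.HX C.rowSpZ DZ t₀ (p := 1 / 4)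
    (by norm_num) (by norm_num) hq0 hq1
  have h1 := C.one_le_uncorrectableProb_add hk (y := 1 / 2) (by norm_num) (by norm_num)
  rw [show (1 : ℝ) - 1 / 2 = 1 / 2 by norm_num, hsymm] at h1
  rw [show (2 : ℝ) * (1 / 4) = 1 / 2 by norm_num] at hZ
  linarith

end CSSAniso

section ThresholdsAniso

open CSSPhenom

variable {RX RZ Q : ℕ → Type*} [∀ i, Fintype (Q i)] [∀ i, DecidableEq (Q i)] [∀ i, Fintype (RX i)]
  [∀ i, DecidableEq (RX i)] [∀ i, Fintype (RZ i)]

/-- **Anisotropic families, erasure-symmetric codes**: for a family of CSS codes with `k ≥ 1` whose sectors share the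
erasure law, rounds `T_i ≥ 1`, ANY space-time decoders and ANY measurement-rate schedule `0 ≤ q_i ≤ 1` (perfect
measurements `q_i = 0` included): every certified threshold lower bound in the qubit-fault rate is `≤ 1/4`
(`P^ph_{1/4, q_i} ≥ 1/4` throughout).
[cite: DennisEtAl2002, §4.2, §4.6 and §5.2; StaceBarrettDoherty2009, p. 2] -/
theorem phenom_aniso_threshold_le_quarter_of_symm (C : ∀ i, CSSCode (RX i) (RZ i) (Q i)) (hk : ∀ i, 0 < (C i).k)
    (hsymm : ∀ i y, ErasureDecoder.uncorrectableProb {x : Q i → ZMod 2 | (C i).HZ *ᵥ x = 0}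
        ((C i).rowSpX : Set (Q i → ZMod 2)) y =
      ErasureDecoder.uncorrectableProb {x : Q i → ZMod 2 | (C i).HX *ᵥ x = 0}
        ((C i).rowSpZ : Set (Q i → ZMod 2)) y)
    (T : ℕ → ℕ) (hT : ∀ i, 0 < T i) (DZ : ∀ i, STDecoder (RX i) (Q i) (T i)) (q : ℕ → ℝ)
    (hq0 : ∀ i, 0 ≤ q i) (hq1 : ∀ i, q i ≤ 1) {a : ℝ}
    (ha : IsThresholdLowerBound
      (fun i p => phenomFailureProb (C i).HX (T i) ((C i).rowSpZ : Set (Q i → ZMod 2)) (DZ i) p (q i)) a) :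
    a ≤ 1 / 4 := by
  by_contra h
  push Not at h
  refine not_belowThreshold_of_le (c := 1 / 4) (by norm_num) (fun i => ?_) (ha (1 / 4) (by norm_num) h)
  exact (C i).quarter_le_zPhenom_quarter_aniso_of_symm (hk i) (hsymm i) (DZ i) ⟨0, hT i⟩ (hq0 i) (hq1 i)

/-- **Anisotropic families, every code with `k ≥ 1`**: no certified threshold lower bound in the qubit-fault rate
exceeds `1/2`, at any measurement-rate schedule `0 ≤ q_i ≤ 1`, for any space-time decoder family.
[cite: DennisEtAl2002, §4.2, §4.6 and §5.2] -/
theorem phenom_aniso_threshold_le_half (C : ∀ i, CSSCode (RX i) (RZ i) (Q i)) (hk : ∀ i, 0 < (C i).k)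
    (T : ℕ → ℕ) (hT : ∀ i, 0 < T i) (DZ : ∀ i, STDecoder (RX i) (Q i) (T i)) (q : ℕ → ℝ)
    (hq0 : ∀ i, 0 ≤ q i) (hq1 : ∀ i, q i ≤ 1) {a : ℝ}
    (ha : IsThresholdLowerBound
      (fun i p => phenomFailureProb (C i).HX (T i) ((C i).rowSpZ : Set (Q i → ZMod 2)) (DZ i) p (q i)) a) :
    a ≤ 1 / 2 := by
  by_contra h
  push Not at h
  refine not_belowThreshold_of_le (c := 1 / 2) (by norm_num) (fun i => ?_) (ha (1 / 2) (by norm_num) h)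
  exact (C i).half_le_zPhenom_half_aniso (hk i) (DZ i) ⟨0, hT i⟩ (hq0 i) (hq1 i)

end ThresholdsAniso

end Literature.InformationTheory.QuantumCodes
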